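import Literature.NumberTheory.GaloisRepresentations.UnramifiedAdmissible
import Literature.NumberTheory.GaloisRepresentations.AbsGaloisGroup
import Literature.RingTheory.GaloisAlgebras.HilbertNinetyAlgebras
import Mathlib.FieldTheory.KrullTopology
import Mathlib.FieldTheory.Galois.Basic
import HarnessLib

/-!
# Potentially trivial `p`-adic representations are `B`-admissible for every period ring containing `F̄`

Let `F` be a field of characteristic `0` with a `ℚ_p`-algebra structure, `Γ_F = Gal(F̄/F)`
(`F̄ = AlgebraicClosure F`), and `𝔅` a period-ring datum (Fontaine regular `(ℚ_p, Γ_F)`-ring with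
invariants `F`, accepted `PeriodRingData`) together with a `Γ_F`-equivariant ring map
`ι : F̄ → B` extending the structure map `F → B`.  Main results:

* `exists_isUnit_forall_eq_mul_map_restrictNormalHom` — **Hilbert 90 period matrix**: if a
  homomorphism `r : Γ_F → GL_N(A)` (coefficients `A → L` fixed by `Gal(L/F)`) is trivial on
  `Gal(F̄/L)` for a finite Galois subextension `L/F` of `F̄`, there is an invertible matrix
  `X ∈ GL_N(L)` with `X = r(σ) · σ(X)` for every `σ ∈ Γ_F` (Speiser / Serre, *Local Fields*, Ch. X
  §1 Prop. 3: `H¹(Gal(L/F), GL_N(L)) = 1`, through the accepted `exists_isUnit_forall_eq`).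
* `PeriodRingData.isAdmissible_of_isOpen` — **every continuous `ℚ_p`-linear representation `ρ` of
  `Γ_F` on a finite-dimensional Hausdorff topological vector space which is trivial on an OPEN
  subgroup of `Γ_F` (potentially trivial; e.g. finite image) is `𝔅`-admissible**:
  `dim_F (B ⊗_{ℚ_p} V)^{Γ_F} = dim_{ℚ_p} V`.  This is Fontaine 1994, Exp. III §1.5–1.6
  (`P̄`-admissible ⇒ `B`-admissible for `B ⊇ P̄`; the `P̄`-admissible representations are exactly the
  potentially trivial ones, Hilbert 90) — for `B = B_dR(F)` the statement "finite-image
  (potentially unramified of weight `0`) representations are de Rham", file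
  `Literature/NumberTheory/PAdicHodge/BdRFiniteImage`.  Proof: an integral frame
  `r : Γ_F →ₜ* GL_N(ℤ_p)` (accepted `ContinuousRep.exists_basis_integralFrame`); the open subgroup
  contains `Gal(F̄/L)` for a finite Galois `L/F` (Mathlib `krullTopology_mem_nhds_one_iff_of_normal`);
  the period matrix `X ∈ GL_N(L)` pushed into `B` through `ι` gives `N` invariant vectors
  `∑ᵢ ι(X_{ij}) ⊗ bᵢ`, linearly independent over `B` hence over `F`; Fontaine's inequality (accepted
  `PeriodRingData.rank_D_le`) gives `≤`.  Same architecture as the accepted unramified case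
  `PeriodRingData.isAdmissible_of_unramified` (Lang's theorem over `𝒪̂_{F_nr}` replaced by
  Hilbert 90 over `L`).

No definitions, no named facts.

## References

* J.-M. Fontaine, *Représentations p-adiques semi-stables*, Astérisque 223 (1994), Exp. III §1.5–1.6.
  [FontaineAsterisque223III]
* J.-P. Serre, *Local Fields*, GTM 67 (1979), Ch. X §1, Prop. 3. [SerreLocalFields1979]
* J.-M. Fontaine, Y. Ouyang, *Theory of p-adic Galois representations*, §2.2 (Hilbert 90 and
  `K̄`-admissibility).
-/

noncomputable section

open Field Matrix TensorProduct
open scoped MatrixGroups TensorProduct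

namespace Literature.NumberTheory.GaloisRepresentations

universe u w w'

/-! ### Hilbert 90: the period matrix over a finite Galois subextension -/

section PeriodMatrix

open Literature.RingTheory.GaloisAlgebras

variable {F : Type u} [Field F] [CharZero F]

/-- **Hilbert 90 period matrix.**  Let `L ⊆ F̄` be a finite Galois extension of `F`,
`φ : A → L` a ring map whose image is fixed by `Gal(L/F)`, and `r : Γ_F → GL_N(A)` a homomorphism
trivial on `Gal(F̄/L)`.  Then there is an invertible `X ∈ M_N(L)` with `X = φ(r σ) · σ(X)` for all
`σ ∈ Γ_F` (entrywise action through `Gal(L/F)`): the class of the cocycle `σ ↦ r(σ)` in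
`H¹(Gal(L/F), GL_N(L)) = 1` (Speiser; Serre, *Local Fields*, Ch. X §1, Prop. 3), obtained from the
accepted invariant-unit form of Hilbert 90 (`exists_isUnit_forall_eq`) for the semilinear action
`M ↦ r(g) · g(M)` on `M_N(L)`. [cite: SerreLocalFields1979, Ch. X, §1, Prop. 3] -/
theorem exists_isUnit_forall_eq_mul_map_restrictNormalHom
    {N : Type*} [Fintype N] [DecidableEq N]
    (L : IntermediateField F (AlgebraicClosure F)) [FiniteDimensional F L] [Normal F L]
    {A : Type*} [CommRing A] (φ : A →+* L) (hφ : ∀ (g : L ≃ₐ[F] L) (a : A), g (φ a) = φ a)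
    (r : absoluteGaloisGroup F →* GL N A)
    (hr : ∀ σ : absoluteGaloisGroup F,
      absoluteGaloisGroup.toAlgEquiv F σ ∈ L.fixingSubgroup → r σ = 1) :
    ∃ X : Matrix N N L, IsUnit X ∧ ∀ σ : absoluteGaloisGroup F,
      X = φ.mapMatrix ((r σ : GL N A) : Matrix N N A) *
        X.map (AlgEquiv.restrictNormalHom L (absoluteGaloisGroup.toAlgEquiv F σ)) := by
  classical
  -- restriction to `L`
  let res : absoluteGaloisGroup F →* (L ≃ₐ[F] L) :=
    (AlgEquiv.restrictNormalHom L).comp (absoluteGaloisGroup.toAlgEquiv F).toMonoidHom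
  have hres : ∀ σ, res σ = AlgEquiv.restrictNormalHom L (absoluteGaloisGroup.toAlgEquiv F σ) :=
    fun _ => rfl
  -- `r` factors through `res`
  have hker : ∀ σ τ : absoluteGaloisGroup F, res σ = res τ → r σ = r τ := by
    intro σ τ h
    have h1 : res (τ⁻¹ * σ) = 1 := by rw [map_mul, map_inv, h, inv_mul_cancel]
    have h2 : absoluteGaloisGroup.toAlgEquiv F (τ⁻¹ * σ) ∈ L.fixingSubgroup := by
      rw [← IntermediateField.restrictNormalHom_ker, MonoidHom.mem_ker]
      exact h1
    have h3 : r (τ⁻¹ * σ) = 1 := hr _ h2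
    rw [map_mul, map_inv, inv_mul_eq_one] at h3
    exact h3.symm
  -- a set-theoretic section of `res`
  have hsurj : Function.Surjective res := by
    intro g
    obtain ⟨σ, hσ⟩ := AlgEquiv.restrictNormalHom_surjective (F := F) (K₁ := L)
      (E := AlgebraicClosure F) g
    exact ⟨(absoluteGaloisGroup.toAlgEquiv F).symm σ, by rw [← hσ]; rfl⟩
  let s : (L ≃ₐ[F] L) → absoluteGaloisGroup F := Function.surjInv hsurj
  have hs : ∀ g, res (s g) = g := Function.surjInv_eq hsurj
  -- the lifted cocycle with values in `M_N(L)`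
  let rL : (L ≃ₐ[F] L) → Matrix N N L := fun g => φ.mapMatrix ((r (s g) : GL N A) : Matrix N N A)
  have hrL_res : ∀ σ, rL (res σ) = φ.mapMatrix ((r σ : GL N A) : Matrix N N A) := by
    intro σ
    simp only [rL]
    rw [hker (s (res σ)) σ (hs (res σ))]
  have hrL_one : rL 1 = 1 := by
    have h : rL (res 1) = 1 := by rw [hrL_res, map_one, Units.val_one, map_one]
    rwa [map_one] at h
  have hrL_mul : ∀ g h, rL (g * h) = rL g * rL h := by
    intro g h
    have h1 : r (s (g * h)) = r (s g * s h) := hker _ _ (by rw [map_mul, hs, hs, hs])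
    simp only [rL]
    rw [h1, map_mul, Units.val_mul, map_mul]
  have hrL_fix : ∀ (g h : L ≃ₐ[F] L), (rL h).map g = rL h := by
    intro g h
    ext i j
    simp only [rL, Matrix.map_apply, RingHom.mapMatrix_apply, hφ]
  -- the twisted semilinear action `M ↦ rL g · g(M)` on `M_N(L)`
  let act : (L ≃ₐ[F] L) → Matrix N N L → Matrix N N L := fun g M => rL g * M.map g
  have hact_add : ∀ g (M M' : Matrix N N L), act g (M + M') = act g M + act g M' := by
    intro g M M'
    simp only [act]
    rw [Matrix.map_add _ (map_add g), mul_add]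
  let ρ'fun : (L ≃ₐ[F] L) → AddMonoid.End (Matrix N N L) := fun g =>
    { toFun := act g
      map_zero' := by
        simp only [act]
        rw [Matrix.map_zero _ (map_zero g), mul_zero]
      map_add' := hact_add g }
  have hρ'fun : ∀ g M, ρ'fun g M = rL g * M.map g := fun _ _ => rfl
  let ρ' : (L ≃ₐ[F] L) →* AddMonoid.End (Matrix N N L) :=
    { toFun := ρ'fun
      map_one' := AddMonoidHom.ext fun M => by
        show rL 1 * M.map ⇑(1 : L ≃ₐ[F] L) = M
        rw [hrL_one, one_mul]
        exact Matrix.ext fun i j => rfl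
      map_mul' := fun g h => AddMonoidHom.ext fun M => by
        show rL (g * h) * M.map ⇑(g * h) = rL g * (rL h * M.map ⇑h).map ⇑g
        rw [Matrix.map_mul, hrL_fix, Matrix.map_map, hrL_mul, mul_assoc]
        rfl }
  have hρ'apply : ∀ g M, ρ' g M = rL g * M.map g := fun _ _ => rfl
  have hρ' : ∀ (g : L ≃ₐ[F] L) (e : L) (M : Matrix N N L), ρ' g (e • M) = (g • e) • ρ' g M := by
    intro g e M
    rw [hρ'apply, hρ'apply, Matrix.map_smul' _ _ _ (map_mul g), AlgEquiv.smul_def, mul_smul_comm]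
  have hinf : {e : L | ∀ g : L ≃ₐ[F] L, g • e = e}.Infinite := infinite_fixedPoints_of_charZero _ _
  obtain ⟨X, hXu, hX⟩ := exists_isUnit_forall_eq hinf ρ' hρ'
  refine ⟨X, hXu, fun σ => ?_⟩
  have h := hX (res σ)
  rw [hρ'apply, hrL_res] at h
  rw [← hres]
  exact h.symm

end PeriodMatrix

/-! ### Admissibility of potentially trivial representations -/

section Admissible

variable {F : Type u} [Field F] [CharZero F] {p : ℕ} [Fact p.Prime] [Algebra ℚ_[p] F]

-- Mathlib's own global value of `maxSynthPendingDepth` (see `PeriodRingData.rank_D_le`).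
set_option maxSynthPendingDepth 3 in
/-- **Potentially trivial representations are `B`-admissible for every period ring `B` receiving
`F̄`.**  Let `𝔅` be a period-ring datum for `Γ_F` over `ℚ_p` with invariants `F`, and
`ι : F̄ → B` a `Γ_F`-equivariant ring map extending `F → B`.  Then every continuous
representation `ρ` of `Γ_F` on a finite-dimensional Hausdorff topological `ℚ_p`-vector space `V`
which is trivial on an open subgroup `H ≤ Γ_F` satisfies `dim_F (B ⊗_{ℚ_p} V)^{Γ_F} = dim_{ℚ_p} V`
(Fontaine 1994, Exp. III §1.5–1.6: `ρ` is `F̄`-admissible by Hilbert 90 over a finite Galois `L/F`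
with `Gal(F̄/L) ≤ H`, a fortiori `B`-admissible).  For `B = B_dR(F)`: finite-image
representations are de Rham. [cite: FontaineAsterisque223III, Exp. III §1.5] -/
theorem PeriodRingData.isAdmissible_of_isOpen
    (𝔅 : PeriodRingData.{u, 0, u, w} (absoluteGaloisGroup F) ℚ_[p] F)
    (ι : AlgebraicClosure F →+* 𝔅.B)
    (hισ : ∀ (σ : absoluteGaloisGroup F) (x : AlgebraicClosure F), σ • ι x = ι (σ • x))
    (hιa : ∀ a : F, ι (algebraMap F (AlgebraicClosure F) a) = algebraMap F 𝔅.B a)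
    {V : Type w'} [AddCommGroup V] [Module ℚ_[p] V] [TopologicalSpace V] [IsTopologicalAddGroup V]
    [ContinuousSMul ℚ_[p] V] [T2Space V] [FiniteDimensional ℚ_[p] V]
    (ρ : ContinuousRep (absoluteGaloisGroup F) ℚ_[p] V)
    (H : Subgroup (absoluteGaloisGroup F)) (hH : IsOpen (H : Set (absoluteGaloisGroup F)))
    (hρ : ∀ σ ∈ H, ∀ v : V, ρ σ v = v) :
    𝔅.IsAdmissible ρ := by
  classical
  set N := Module.finrank ℚ_[p] V with hN
  -- an integral frame
  obtain ⟨b, r, hbr⟩ := ρ.exists_basis_integralFrame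
  -- `r` is trivial on `H`
  have hr : ∀ σ ∈ H, r σ = 1 := by
    intro σ hσ
    refine Units.ext (Matrix.ext fun i j => PadicInt.ext ?_)
    have h1 := hbr σ j
    rw [hρ σ hσ] at h1
    have h2 := congrArg (fun v => b.repr v i) h1
    simp only [b.repr_sum_self, b.repr_self_apply] at h2
    rw [← h2, Units.val_one, Matrix.one_apply]
    by_cases hij : i = j
    · subst hij; simp
    · rw [if_neg (Ne.symm hij), if_neg hij, PadicInt.coe_zero]
  -- a finite Galois `L/F` with `Gal(F̄/L) ≤ H`
  obtain ⟨L, hLfin, hLnormal, hLH⟩ :=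
    (krullTopology_mem_nhds_one_iff_of_normal F (AlgebraicClosure F)
      (H : Set (absoluteGaloisGroup F))).1 (hH.mem_nhds H.one_mem)
  haveI := hLfin
  haveI := hLnormal
  -- the period matrix over `L` (Hilbert 90) and its image `Y` in `B`
  let φ : ℤ_[p] →+* L := (algebraMap F L).comp ((algebraMap ℚ_[p] F).comp PadicInt.Coe.ringHom)
  have hφ : ∀ (g : L ≃ₐ[F] L) (z : ℤ_[p]), g (φ z) = φ z := fun g z => g.commutes _
  obtain ⟨X, hXu, hX⟩ := exists_isUnit_forall_eq_mul_map_restrictNormalHom L φ hφ r.toMonoidHom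
    (fun σ hσ => hr σ (hLH hσ))
  let ιL : L →+* 𝔅.B := ι.comp (algebraMap L (AlgebraicClosure F))
  have hιLσ : ∀ (σ : absoluteGaloisGroup F) (x : L),
      σ • ιL x = ιL (AlgEquiv.restrictNormalHom L (absoluteGaloisGroup.toAlgEquiv F σ) x) := by
    intro σ x
    simp only [ιL, RingHom.comp_apply]
    rw [hισ, IntermediateField.algebraMap_apply, IntermediateField.algebraMap_apply,
      AlgEquiv.restrictNormalHom_apply]
    rfl
  have hιp : ∀ z : ℤ_[p], ιL (φ z) = algebraMap ℚ_[p] 𝔅.B (z : ℚ_[p]) := by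
    intro z
    change ι (algebraMap L (AlgebraicClosure F)
      (algebraMap F L (algebraMap ℚ_[p] F (z : ℚ_[p])))) = _
    rw [← IsScalarTower.algebraMap_apply F L (AlgebraicClosure F), hιa]
    exact (PeriodRingData.algebraMap_eq 𝔅 _).symm
  set Y : Matrix (Fin N) (Fin N) 𝔅.B := ιL.mapMatrix X with hYdef
  have hYapply : ∀ i j, Y i j = ιL (X i j) := fun i j => rfl
  have hY : ∀ (σ : absoluteGaloisGroup F) (k j : Fin N),
      Y k j = ∑ i, (((r σ : GL (Fin N) ℤ_[p]) : Matrix (Fin N) (Fin N) ℤ_[p]) k i : ℚ_[p]) • σ • Y i j := by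
    intro σ k j
    have h := congrArg (fun M : Matrix (Fin N) (Fin N) L => ιL (M k j)) (hX σ)
    simp only [Matrix.mul_apply, map_sum, map_mul] at h
    rw [hYapply, h]
    refine Finset.sum_congr rfl fun i _ => ?_
    simp only [RingHom.mapMatrix_apply, Matrix.map_apply]
    rw [← hιLσ, hYapply, Algebra.smul_def, ← hιp]
    rfl
  -- the invariant vectors
  let w : Fin N → 𝔅.B ⊗[ℚ_[p]] V := fun j => ∑ i, Y i j ⊗ₜ[ℚ_[p]] b i
  have hwD : ∀ j, w j ∈ 𝔅.D ρ := by
    intro j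
    rw [PeriodRingData.mem_D_iff]
    intro σ
    simp only [w, map_sum, PeriodRingData.tensorRep_apply_tmul]
    calc ∑ i, (σ • Y i j) ⊗ₜ[ℚ_[p]] ρ σ (b i)
        = ∑ i, ∑ k, ((((r σ : GL (Fin N) ℤ_[p]) : Matrix (Fin N) (Fin N) ℤ_[p]) k i : ℚ_[p]) • σ • Y i j) ⊗ₜ[ℚ_[p]] b k := by
          refine Finset.sum_congr rfl fun i _ => ?_
          rw [hbr σ i, TensorProduct.tmul_sum]
          refine Finset.sum_congr rfl fun k _ => ?_
          exact (TensorProduct.smul_tmul _ _ _).symm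
      _ = ∑ k, (∑ i, (((r σ : GL (Fin N) ℤ_[p]) : Matrix (Fin N) (Fin N) ℤ_[p]) k i : ℚ_[p]) • σ • Y i j) ⊗ₜ[ℚ_[p]] b k := by
          rw [Finset.sum_comm]
          refine Finset.sum_congr rfl fun k _ => ?_
          rw [TensorProduct.sum_tmul]
      _ = ∑ k, Y k j ⊗ₜ[ℚ_[p]] b k := Finset.sum_congr rfl fun k _ => by rw [← hY σ k j]
  -- they are linearly independent over `B`, hence over `F`
  let β : Module.Basis (Fin N) 𝔅.B (𝔅.B ⊗[ℚ_[p]] V) := Algebra.TensorProduct.basis 𝔅.B b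
  have hYdet : IsUnit Y.det := (Matrix.isUnit_iff_isUnit_det _).1 (hXu.map ιL.mapMatrix)
  have hw : ∀ j, w j = Matrix.toLin β β Y (β j) := by
    intro j
    rw [Matrix.toLin_self]
    refine Finset.sum_congr rfl fun i _ => ?_
    rw [Algebra.TensorProduct.basis_apply, TensorProduct.smul_tmul', smul_eq_mul, mul_one]
  have hliB : LinearIndependent 𝔅.B w := by
    have h := β.linearIndependent.map' (Matrix.toLin β β Y) (Matrix.ker_toLin_eq_bot β Y hYdet)
    rw [show w = ⇑(Matrix.toLin β β Y) ∘ ⇑β from funext hw]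
    exact h
  have hliF : LinearIndependent F w := by
    refine hliB.restrict_scalars ?_
    intro x y hxy
    have h : algebraMap F 𝔅.B x = algebraMap F 𝔅.B y := by
      simpa only [Algebra.smul_def, mul_one] using hxy
    exact (algebraMap F 𝔅.B).injective h
  -- count dimensions
  have hliD : LinearIndependent F (fun j => (⟨w j, hwD j⟩ : 𝔅.D ρ)) :=
    LinearIndependent.of_comp (𝔅.D ρ).subtype (by exact hliF)
  have h1 : (N : Cardinal) ≤ Module.rank F (𝔅.D ρ) := by
    simpa using hliD.cardinal_lift_le_rank
  have h2 : Module.rank F (𝔅.D ρ) ≤ N := 𝔅.rank_D_le ρ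
  exact Module.finrank_eq_of_rank_eq (le_antisymm h2 h1)

end Admissible

end Literature.NumberTheory.GaloisRepresentations

end
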